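import Summits.BirchSwinnertonDyer.BirchSwinnertonDyer.Theorems.GoldfeldAllTwistsTwoConverseTwinAdditiveReduction
import HarnessLib

set_option linter.dupNamespace false -- namespace `…BirchSwinnertonDyer.BirchSwinnertonDyer…` is the cell's (D-0017 nested layout)
set_option autoImplicit false

/-!
# Route `GoldfeldAllTwistsTwoConverse`, crux twin″ `BSDTwoCMSevenAdditiveRankOne` (item 19140):
# the additive cell is the union of THREE good-type twist families of fixed base curves

Cell `bsd-goldfeld`, seat `bsd-goldfeld-s1p-c301` (prover), file 3 on item `stmt-BirchSwinnertonDyer-19140`.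
Theorems only; no definition, no axiom, no `sorry`.

File 1 (`…TwinAdditiveReduction`, p418210) put the item in twist currency: up to Cassels' isogeny
transport it is `BSD(·,2)` for the minimal models of the analytic-rank-one twists `49a1^{(d)}`, `d`
squarefree, `d ≢ 1 (mod 4)`. Here the twisting parameter is normalised further:

* `exists_base_and_good_twist_of_squarefree_of_emod_four_ne_one`: a squarefree `d ≢ 1 (mod 4)` is
  `ε·m` with `ε ∈ {−1, 2, −2}` and `m ≡ 1 (mod 4)` squarefree (elementary);
* `exists_baseTwist_of_j_neg3375_of_not_good_two`: hence every globally minimal `W` with `j = −3375`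
  and bad reduction at `2` is a minimal model of `B_ε^{(m)}` with `B_ε = cm7^{(ε)}` one of the THREE base
  curves `49a1^{(−1)}` (conductor `784 = 28²`), `49a1^{(2)}`, `49a1^{(−2)}` (conductor `3136 = 56²`) and
  `m ≡ 1 (mod 4)` — a twist of GOOD type at `2` (`ℚ(√m)/ℚ` unramified at `2`), exactly the shape
  `E^{(M)}`, `M ≡ 1 (mod 4)`, of Coates–Li–Tian–Zhai 2015 Thm. 1.1 / §2 (base curve `E` with
  `E(ℚ)[2] = ℤ/2`, Heegner points on `X₀(C)`, induction on the prime factors of `M`; their hypothesis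
  "`C` a square mod `q₁`" is automatic for `C ∈ {28², 56²}`), by `quadraticTwist_quadraticTwist`;
* `bsdTwoCMSevenAdditiveRankOne_of_baseTwists`: so, granted Cassels/GZK/analytic continuation,
  `BSD(·,2)` for the minimal models of the analytic-rank-one twists `B_ε^{(m)}` (`ε ∈ {−1,2,−2}`,
  `m ≡ 1 (mod 4)` squarefree) implies the item: the cell is THREE Tian–CLTZ-type families over fixed
  additive-at-`2` base curves, and nothing else.

HONEST FRAMING: organisational; nothing here proves `BSD(W,2)` for a single curve. The `2`-part in
analytic rank one is not in print for these families (CLTZ 2015 p. 360: "we still do not know enough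
at present to prove that the orders of the Tate–Shafarevich groups … are as predicted", already for
the good family; Li–Tian–Yan–Zhu 2025 §1.3 (II) excludes `2 ∣ N`).

References: J. Coates, Y. Li, Y. Tian, S. Zhai, PLMS 110 (2015) Thm. 1.1, §2 [CoatesLiTianZhai2015];
J. H. Silverman, *AEC* (2009) X.2 Prop. 2.4, X.5 Cor. 5.4.1 [SilvermanAEC2009]; R. L. Miller, LMS J.
Comput. Math. 14 (2011) Def. 1.1 [Miller2011LMS]; Y.-X. Li, Y. Tian, X. Yan, X. Zhu, PAMQ 21 (2025)
§1.3 [LiTianYanZhu2025].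
-/

noncomputable section

open scoped Classical

open WeierstrassCurve Literature.NumberTheory.EllipticCurves
  Literature.NumberTheory.EllipticCurves.Rank1Residual

namespace Summit.BirchSwinnertonDyer.BirchSwinnertonDyer.Theorems.GoldfeldGoodTwists

/-! ## §1 Elementary: `d ≢ 1 (mod 4)` squarefree is `ε·m`, `ε ∈ {−1, 2, −2}`, `m ≡ 1 (mod 4)` -/

/-- A squarefree integer `d ≢ 1 (mod 4)` factors as `d = ε·m` with `ε ∈ {−1, 2, −2}` and `m ≡ 1 (mod 4)`
squarefree: `d ≡ 3 (mod 4)` gives `ε = −1`; `d ≡ 2 (mod 4)` gives `ε = ±2` according to `d/2 mod 4`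
(`4 ∤ d` by squarefreeness). [folklore] -/
theorem exists_base_and_good_twist_of_squarefree_of_emod_four_ne_one {d : ℤ} (hsq : Squarefree d)
    (hd4 : d % 4 ≠ 1) :
    ∃ ε m : ℤ, (ε = -1 ∨ ε = 2 ∨ ε = -2) ∧ m % 4 = 1 ∧ Squarefree m ∧ d = ε * m := by
  have h4 : ¬ (4 : ℤ) ∣ d := by
    intro h
    have h22 : (2 : ℤ) * 2 ∣ d := by simpa [show (2:ℤ) * 2 = 4 by norm_num] using h
    have := hsq 2 h22
    exact absurd (Int.isUnit_iff.mp this) (by decide)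
  rcases Int.emod_two_eq_zero_or_one d with he | ho
  · -- `d` even: `d = 2 m'`, `m'` odd
    obtain ⟨m', rfl⟩ : (2 : ℤ) ∣ d := Int.dvd_of_emod_eq_zero he
    have hm'odd : m' % 2 = 1 := by
      rcases Int.emod_two_eq_zero_or_one m' with h0 | h1
      · exact absurd (by omega : (4 : ℤ) ∣ 2 * m') h4
      · exact h1
    have hsqm' : Squarefree m' := hsq.of_mul_right
    rcases (by omega : m' % 4 = 1 ∨ m' % 4 = 3) with h1 | h3
    · exact ⟨2, m', Or.inr (Or.inl rfl), h1, hsqm', by ring⟩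
    · refine ⟨-2, -m', Or.inr (Or.inr rfl), by omega, ?_, by ring⟩
      exact hsq.squarefree_of_dvd ⟨-2, by ring⟩
  · -- `d` odd, `d ≢ 1 (mod 4)`: `d ≡ 3 (mod 4)`, `m = -d`
    refine ⟨-1, -d, Or.inl rfl, by omega, ?_, by ring⟩
    exact hsq.squarefree_of_dvd ⟨-1, by ring⟩

/-! ## §2 The cell as three good-type twist families of fixed additive base curves -/

/-- **Every globally minimal `W` with `j = −3375` and bad reduction at `2` is a minimal model of
`(49a1^{(ε)})^{(m)}` with `ε ∈ {−1, 2, −2}` and `m ≡ 1 (mod 4)` squarefree** — a GOOD-type quadratic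
twist (unramified at `2`) of one of the three additive-at-`2` base curves `49a1^{(−1)}` (`N = 784 = 28²`),
`49a1^{(±2)}` (`N = 3136 = 56²`): file 1's `exists_squarefree_twist_of_j_neg3375_of_not_good_two`, §1,
and `(cm7^{(ε)})^{(m)} = cm7^{(ε m)}` on the nose (`quadraticTwist_quadraticTwist`).
[cite: SilvermanAEC2009, X.5 Prop. 5.4 and Cor. 5.4.1] [cite: CoatesLiTianZhai2015, Thm. 1.1 (shape E^{(M)}, M ≡ 1 mod 4)] -/
theorem exists_baseTwist_of_j_neg3375_of_not_good_two (W : WeierstrassCurve ℚ) [W.IsElliptic]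
    [W.IsGloballyMinimal] (hj : W.j = -3375) (hg : ¬ W.HasGoodReductionAtPrime 2) :
    ∃ ε m : ℤ, (ε = -1 ∨ ε = 2 ∨ ε = -2) ∧ m % 4 = 1 ∧ Squarefree m ∧
      ∃ C : VariableChange ℚ, C • W = (cm7.quadraticTwist (ε : ℚ)).quadraticTwist (m : ℚ) := by
  obtain ⟨d, _, hsq, hd4, C, hC⟩ := exists_squarefree_twist_of_j_neg3375_of_not_good_two W hj hg
  obtain ⟨ε, m, hε, hm4, hsqm, rfl⟩ := exists_base_and_good_twist_of_squarefree_of_emod_four_ne_one hsq hd4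
  refine ⟨ε, m, hε, hm4, hsqm, C, ?_⟩
  rw [hC, quadraticTwist_quadraticTwist, Int.cast_mul]

/-- **The item from `BSD(·,2)` on the three base-curve families.** Granted Cassels (`hCassels`), GZK
(`hGZK`) and analytic continuation (`hmod`): if `BSD(W′,2)` holds for every globally minimal model `W′` of
every analytic-rank-one twist `(49a1^{(ε)})^{(m)}`, `ε ∈ {−1, 2, −2}`, `m ≡ 1 (mod 4)` squarefree, then
twin″ holds. (File 1's `bsdTwoCMSevenAdditiveRankOne_of_twists` with the parameter normalised by §2.)
[cite: CoatesLiTianZhai2015, Thm. 1.1 and §2 (base curve with a rational 2-torsion point)]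
[cite: MilneADT2006, Thm. I.7.3] [cite: Miller2011LMS, Def. 1.1] -/
theorem bsdTwoCMSevenAdditiveRankOne_of_baseTwists (hCassels : bsdRHS_eq_of_isIsogenous)
    (hGZK : rank_eq_analyticRank_of_analyticRank_le_one) (hmod : hasEntireLFunction_rat)
    (h : ∀ (ε m : ℤ), (ε = -1 ∨ ε = 2 ∨ ε = -2) → m % 4 = 1 → Squarefree m →
      ∀ (W' : WeierstrassCurve ℚ) [W'.IsElliptic] [W'.IsGloballyMinimal] (C : VariableChange ℚ),
        C • W' = (cm7.quadraticTwist (ε : ℚ)).quadraticTwist (m : ℚ) → W'.analyticRank = 1 → BSDp W' 2) :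
    Summit.BirchSwinnertonDyer.BirchSwinnertonDyer.Theses.GoldfeldAllTwistsTwoConverse.BSDTwoCMSevenAdditiveRankOne := by
  refine bsdTwoCMSevenAdditiveRankOne_of_j_neg3375 hCassels hGZK hmod fun W _ _ hj hg har => ?_
  obtain ⟨ε, m, hε, hm4, hsqm, C, hC⟩ := exists_baseTwist_of_j_neg3375_of_not_good_two W hj hg
  exact h ε m hε hm4 hsqm W C hC har

/-- **Conversely (unconditional): the item gives `BSD(W′,2)` for every globally minimal model of every
twist `(49a1^{(ε)})^{(m)}` (`ε m ≠ 0`) that is bad at `2`, in analytic rank one.** [cite: Miller2011LMS, Def. 1.1] -/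
theorem bsdTwo_baseTwists_of_bsdTwoCMSevenAdditiveRankOne
    (h : Summit.BirchSwinnertonDyer.BirchSwinnertonDyer.Theses.GoldfeldAllTwistsTwoConverse.BSDTwoCMSevenAdditiveRankOne)
    {ε m : ℤ} (hεm : ε * m ≠ 0) (W' : WeierstrassCurve ℚ) [W'.IsElliptic] [W'.IsGloballyMinimal]
    (C : VariableChange ℚ) (hC : C • W' = (cm7.quadraticTwist (ε : ℚ)).quadraticTwist (m : ℚ))
    (hg : ¬ W'.HasGoodReductionAtPrime 2) (har : W'.analyticRank = 1) : BSDp W' 2 := by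
  rw [quadraticTwist_quadraticTwist, ← Int.cast_mul] at hC
  exact bsdTwo_twists_additive_of_bsdTwoCMSevenAdditiveRankOne h hεm W' C hC hg har

end Summit.BirchSwinnertonDyer.BirchSwinnertonDyer.Theorems.GoldfeldGoodTwists

end
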